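import Literature.NumberTheory.LFunctions.MertensFirstChainCheck
import Literature.NumberTheory.LFunctions.ThetaChainSound
import Literature.NumberTheory.LFunctions.RosserSchoenfeldMertensFirstConstant
import Literature.NumberTheory.LFunctions.RosserSchoenfeldVonMangoldtSum
import HarnessLib

/-!
# Rosser–Schoenfeld's (3.22) on a finite range by kernel computation: soundness of the checker

Topic: `Literature/NumberTheory/LFunctions`. THEOREMS (everything proved; no named fact is introduced).
Part of the discharge programme of `Literature.NumberTheory.LFunctions.RosserSchoenfeld1962_eq_3_22`
(Rosser–Schoenfeld 1962, Thm. 6 (3.22): `∑_{p ≤ x} (log p)/p < log x + E + 1/(2 log x)`, `x ≥ 319`).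
The semantic soundness of the Mertens-chain checker `MertensFirstChainCheck.lean` over the complete
prime table `ChainTable.table` (`ChainTableFacts.tableOK`), exactly parallel to `ThetaChainSound.lean`:

* `Inv s` (for a state at the prime `p = s.p`): `p` is a table entry and prime; `Llo ≤ 2⁸⁰ log p ≤ Lhi`;
  the majorants `2⁸⁰ S(p) ≤ Shi` (`S(x) = ∑_{q ≤ x} (log q)/q`, `mertensS`) and
  `2⁸⁰ ∑_{q ≤ p} (log q)/(q(q−1)) ≤ Ghi` (`partialG`); the comparison at `p` itself,
  `2⁸⁰ S(p) + ELO < 2⁸⁰ (log p + 1/(2 log p))` once `p ≥ 331`; and the target comparison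
  `2⁸⁰ S(x) + ELO < 2⁸⁰ (log x + 1/(2 log x))` for all real `319 ≤ x < p`.
* `stepM_inv`, `runM_sound`, `runDM_sound`, `initM_inv` — the invariant is established and preserved
  (one step: the successor `p'` is prime with no prime in `(p, p')`, so `S ≡ S(p)` on `[p, p')` and
  `S(p') = S(p) + (log p')/p'`; `chkM_sound`; the right-hand side `log x + 1/(2 log x)` is
  non-decreasing for `x ≥ 3` (`rhs_mono`); the interval `[319, 331)` through `chk319`).
* `rosserSchoenfeldE_ge_of_inv` — **the lower bound for `E`** from a final state at a prime `P`:
  `E = −γ − ∑_p (log p)/(p(p−1)) ≥ −γ − Ghi/2⁸⁰ − (log P + 2)/P` (the tree's `γ < 0.57721571`,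
  `Literature.Analysis.SpecialFunctions.Real.eulerMascheroniConstant_lt_d8`, and the telescoped
  integer tail `RosserSchoenfeld.sum_range_log_div_mul_pred_le`), so that a decidable comparison of
  natural numbers on the final state gives `−ELO/2⁸⁰ ≤ E`.
* `eq_3_22_of_inv` — from `Inv s`, `s.p ≥ 331` and `−ELO/2⁸⁰ ≤ E`: (3.22) for all real
  `319 ≤ x ≤ s.p`.

## References

* J. B. Rosser, L. Schoenfeld, Illinois J. Math. 6 (1962), 64–94, Thm. 6 (3.22), (2.10)–(2.11), p. 87.
  [RosserSchoenfeld1962]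
-/

noncomputable section

namespace Literature.NumberTheory.LFunctions.MertensFirstChain

open ChainCheck ChainTable ThetaChain Real Finset

/-! ### The two prime sums along the integers -/

/-- `S(x) = ∑_{p ≤ x} (log p)/p` (the left-hand side of (3.22), over `Nat.primesLE ⌊x⌋₊`).
[cite: RosserSchoenfeld1962, Thm. 6] -/
def mertensS (x : ℝ) : ℝ := ∑ p ∈ Nat.primesLE ⌊x⌋₊, Real.log p / p

/-- The partial sums `∑_{p ≤ n} (log p)/(p(p−1))` of the series in `E = −γ − ∑_p (log p)/(p(p−1))`.
[cite: RosserSchoenfeld1962, (2.10)] -/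
def partialG (n : ℕ) : ℝ := ∑ p ∈ Nat.primesLE n, Real.log p / ((p : ℝ) * ((p : ℝ) - 1))

/-- `∑_{p ∈ primesLE (n+1)} f = ∑_{p ∈ primesLE n} f + [n+1 prime] f(n+1)`. [folklore] -/
theorem sum_primesLE_succ (f : ℕ → ℝ) (n : ℕ) :
    ∑ p ∈ Nat.primesLE (n + 1), f p = ∑ p ∈ Nat.primesLE n, f p + if (n + 1).Prime then f (n + 1) else 0 := by
  rw [Nat.primesLE_succ]
  split_ifs with h
  · rw [Finset.sum_insert, add_comm]
    intro hmem
    have := (Nat.mem_primesLE.1 hmem).1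
    omega
  · rw [add_zero]

/-- `S(n+1) = S(n) + [n+1 prime] log(n+1)/(n+1)`. [folklore] -/
theorem mertensS_natSucc (n : ℕ) :
    mertensS ((n + 1 : ℕ) : ℝ) = mertensS (n : ℝ) +
      if (n + 1).Prime then Real.log ((n + 1 : ℕ) : ℝ) / ((n + 1 : ℕ) : ℝ) else 0 := by
  simp only [mertensS, Nat.floor_natCast]
  exact sum_primesLE_succ (fun p ↦ Real.log p / p) n

/-- If there is no prime in `(p, n]` then `S(n) = S(p)`. [folklore] -/
theorem mertensS_eq_of_noPrime {p : ℕ} : ∀ {n : ℕ}, p ≤ n → (∀ q : ℕ, p < q → q ≤ n → ¬ q.Prime) →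
    mertensS (n : ℝ) = mertensS (p : ℝ)
  | 0, h, _ => by
      have : p = 0 := by omega
      subst this; rfl
  | n + 1, h, hq => by
      rcases Nat.eq_or_lt_of_le h with rfl | hlt
      · rfl
      · rw [mertensS_natSucc, if_neg (hq (n + 1) (by omega) le_rfl), add_zero]
        exact mertensS_eq_of_noPrime (by omega) fun q h1 h2 => hq q h1 (by omega)

/-- If `p'` is prime and there is no prime in `(p, p')` then `S(p') = S(p) + (log p')/p'`. [folklore] -/
theorem mertensS_succ_prime {p p' : ℕ} (hp' : p'.Prime) (hlt : p < p')
    (hq : ∀ q : ℕ, p < q → q < p' → ¬ q.Prime) :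
    mertensS (p' : ℝ) = mertensS (p : ℝ) + Real.log p' / p' := by
  obtain ⟨m, rfl⟩ : ∃ m, p' = m + 1 := ⟨p' - 1, by have := hp'.one_lt; omega⟩
  rw [mertensS_natSucc, if_pos hp', mertensS_eq_of_noPrime (by omega) fun q h1 h2 => hq q h1 (by omega)]

/-- `S` is constant on `[p, p')` when there is no prime in `(p, p')`. [folklore] -/
theorem mertensS_real_eq {p p' : ℕ} (hq : ∀ q : ℕ, p < q → q < p' → ¬ q.Prime) {x : ℝ}
    (hpx : (p : ℝ) ≤ x) (hxp : x < p') : mertensS x = mertensS (p : ℝ) := by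
  have hx0 : 0 ≤ x := le_trans (Nat.cast_nonneg p) hpx
  have h1 : p ≤ ⌊x⌋₊ := Nat.le_floor hpx
  have h2 : ⌊x⌋₊ < p' := (Nat.floor_lt hx0).2 hxp
  have : mertensS x = mertensS ((⌊x⌋₊ : ℕ) : ℝ) := by simp only [mertensS, Nat.floor_natCast]
  rw [this]
  exact mertensS_eq_of_noPrime h1 fun q hq1 hq2 => hq q hq1 (by omega)

/-- `∑_{q ≤ n+1} (log q)/(q(q−1)) = ∑_{q ≤ n} + [n+1 prime] log(n+1)/((n+1)n)`. [folklore] -/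
theorem partialG_succ (n : ℕ) :
    partialG (n + 1) = partialG n + if (n + 1).Prime then
      Real.log ((n + 1 : ℕ) : ℝ) / (((n + 1 : ℕ) : ℝ) * (((n + 1 : ℕ) : ℝ) - 1)) else 0 :=
  sum_primesLE_succ _ n

/-- If there is no prime in `(p, n]` then `partialG n = partialG p`. [folklore] -/
theorem partialG_eq_of_noPrime {p : ℕ} : ∀ {n : ℕ}, p ≤ n → (∀ q : ℕ, p < q → q ≤ n → ¬ q.Prime) →
    partialG n = partialG p
  | 0, h, _ => by
      have : p = 0 := by omega
      subst this; rfl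
  | n + 1, h, hq => by
      rcases Nat.eq_or_lt_of_le h with rfl | hlt
      · rfl
      · rw [partialG_succ, if_neg (hq (n + 1) (by omega) le_rfl), add_zero]
        exact partialG_eq_of_noPrime (by omega) fun q h1 h2 => hq q h1 (by omega)

/-- If `p'` is prime with no prime in `(p, p')`: `partialG p' = partialG p + (log p')/(p'(p'−1))`.
[folklore] -/
theorem partialG_succ_prime {p p' : ℕ} (hp' : p'.Prime) (hlt : p < p')
    (hq : ∀ q : ℕ, p < q → q < p' → ¬ q.Prime) :
    partialG p' = partialG p + Real.log p' / ((p' : ℝ) * ((p' : ℝ) - 1)) := by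
  obtain ⟨m, rfl⟩ : ∃ m, p' = m + 1 := ⟨p' - 1, by have := hp'.one_lt; omega⟩
  rw [partialG_succ, if_pos hp', partialG_eq_of_noPrime (by omega) fun q h1 h2 => hq q h1 (by omega)]

/-! ### The right-hand side `log x + 1/(2 log x)` is non-decreasing for `x ≥ 3` -/

/-- For `3 ≤ x ≤ y`: `log x + 1/(2 log x) ≤ log y + 1/(2 log y)` (`u + 1/(2u)` increases for
`u ≥ 1/√2`). [folklore] -/
theorem rhs_mono {x y : ℝ} (hx : 3 ≤ x) (hxy : x ≤ y) :
    Real.log x + 1 / (2 * Real.log x) ≤ Real.log y + 1 / (2 * Real.log y) := by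
  have hu : 1 < Real.log x := MertensBound.one_lt_log_three.trans_le (Real.log_le_log (by norm_num) hx)
  have huv : Real.log x ≤ Real.log y := Real.log_le_log (by linarith) hxy
  set u := Real.log x
  set v := Real.log y
  have hv : 1 < v := hu.trans_le huv
  have key : v + 1 / (2 * v) - (u + 1 / (2 * u)) = (v - u) * (1 - 1 / (2 * u * v)) := by
    field_simp
    ring
  have h1 : 0 ≤ 1 - 1 / (2 * u * v) := by
    rw [sub_nonneg, div_le_one (by positivity)]
    nlinarith
  nlinarith [key, mul_nonneg (sub_nonneg.2 huv) h1]

/-! ### Soundness of the comparison -/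

/-- `ELO` as a real number. [folklore] -/
theorem ELO_real : (ELO : ℝ) = 1611377224964339226965862 := by norm_num [ELO]

/-- **Soundness of `chkM`**: if `chkM Shi Llo Lhi` holds and `Llo ≤ 2⁸⁰ log x ≤ Lhi` with `x > 1`, then
`Shi + ELO < 2⁸⁰ (log x + 1/(2 log x))`. [folklore] -/
theorem chkM_sound {Shi Llo Lhi : ℕ} {x : ℝ} (h : chkM Shi Llo Lhi = true) (hx : 1 < x)
    (hlo : (Llo : ℝ) ≤ 2 ^ 80 * Real.log x) (hhi : 2 ^ 80 * Real.log x ≤ Lhi) :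
    (Shi : ℝ) + ELO < 2 ^ 80 * (Real.log x + 1 / (2 * Real.log x)) := by
  have hlog : 0 < Real.log x := Real.log_pos hx
  have hLhi : (0 : ℝ) < Lhi := lt_of_lt_of_le (by positivity) hhi
  have hLhiN : 0 < 2 * Lhi := by
    have : 0 < Lhi := by exact_mod_cast hLhi
    omega
  have hblt : Shi + ELO < Llo + P160 / (2 * Lhi) := by
    simpa [chkM, Nat.blt_eq, Nat.add_eq, Nat.mul_eq, natdiv_eq] using h
  have hR : (Shi : ℝ) + ELO < Llo + ((P160 / (2 * Lhi) : ℕ) : ℝ) := by exact_mod_cast hblt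
  have hdiv : ((P160 / (2 * Lhi) : ℕ) : ℝ) ≤ (2 : ℝ) ^ 160 / (2 * (Lhi : ℝ)) := by
    have h1 := (natDiv_real_bounds P160 hLhiN).1
    have e1 : ((P160 : ℕ) : ℝ) = 2 ^ 160 := by norm_num [P160]
    have e2 : ((2 * Lhi : ℕ) : ℝ) = 2 * (Lhi : ℝ) := by push_cast; ring
    rw [e1, e2] at h1
    exact h1
  -- `2¹⁶⁰/(2 Lhi) ≤ 2⁸⁰/(2 log x)`
  have hq : (2 : ℝ) ^ 160 / (2 * Lhi) ≤ 2 ^ 80 * (1 / (2 * Real.log x)) := by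
    rw [div_le_iff₀ (by positivity)]
    calc (2 : ℝ) ^ 160 = 2 ^ 80 * (1 / (2 * Real.log x)) * (2 * (2 ^ 80 * Real.log x)) := by
          field_simp
      _ ≤ 2 ^ 80 * (1 / (2 * Real.log x)) * (2 * Lhi) := by
          apply mul_le_mul_of_nonneg_left _ (by positivity); linarith
  linarith

/-- **Soundness of `chk319`**: `Shi + ELO < 2⁸⁰ (log 319 + 1/(2 log 319))`. [folklore] -/
theorem chk319_sound {Shi : ℕ} (h : chk319 Shi = true) :
    (Shi : ℝ) + ELO < 2 ^ 80 * (Real.log 319 + 1 / (2 * Real.log 319)) := by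
  unfold chk319 at h
  rcases hl : logN 319 with _ | ⟨lo3, hi3⟩
  · rw [hl] at h; exact absurd h (by simp)
  · rw [hl] at h
    simp only at h
    obtain ⟨h1, h2, -⟩ := logN_sound hl
    push_cast at h1 h2
    exact chkM_sound h (by norm_num) h1 h2

/-! ### The invariant -/

/-- **The invariant** of a state of the Mertens chain (relative to the table `ChainTable.table`).
[folklore] -/
structure Inv (s : MS) : Prop where
  /-- the prime reached is a table entry -/
  mem : s.p ∈ table
  /-- and is prime -/
  prime : s.p.Prime
  /-- `Llo ≤ 2⁸⁰ log p` -/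
  Llo_le : (s.Llo : ℝ) ≤ 2 ^ 80 * Real.log s.p
  /-- `2⁸⁰ log p ≤ Lhi` -/
  le_Lhi : 2 ^ 80 * Real.log s.p ≤ s.Lhi
  /-- `2⁸⁰ S(p) ≤ Shi` -/
  S_le : 2 ^ 80 * mertensS (s.p : ℝ) ≤ s.Shi
  /-- `2⁸⁰ ∑_{q ≤ p} (log q)/(q(q−1)) ≤ Ghi` -/
  G_le : 2 ^ 80 * partialG s.p ≤ s.Ghi
  /-- the comparison at `p` once `p ≥ 331` -/
  at_p : 331 ≤ s.p → 2 ^ 80 * mertensS (s.p : ℝ) + ELO < 2 ^ 80 * (Real.log s.p + 1 / (2 * Real.log s.p))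
  /-- the comparison below `p` -/
  good : ∀ x : ℝ, 319 ≤ x → x < s.p →
    2 ^ 80 * mertensS x + ELO < 2 ^ 80 * (Real.log x + 1 / (2 * Real.log x))

/-! ### One step -/

/-- `331` is prime. [folklore] -/
theorem prime_331 : Nat.Prime 331 := by norm_num

/-- The only prime in `(319, 331]` is `331`. [folklore] -/
theorem eq_331_of_prime {n : ℕ} (hn : n.Prime) (h1 : 319 < n) (h2 : n ≤ 331) : n = 331 := by
  interval_cases n <;> first | rfl | exact absurd hn (by norm_num)

/-- **Soundness of one step.** If `Inv s` holds, `p'` is the table successor of `s.p`, and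
`stepM s p' = some s'`, then `Inv s'` and `s'.p = p'`. [cite: RosserSchoenfeld1962, Thm. 6 (3.22)] -/
theorem stepM_inv {s s' : MS} (hI : Inv s) {p' : ℕ} {rest : List ℕ}
    (hafter : after s.p table = p' :: rest) (h : stepM s p' = some s') : Inv s' ∧ s'.p = p' := by
  have hT := tableOK
  obtain ⟨p, Llo, Lhi, Shi, Ghi⟩ := s
  simp only at hafter hI
  obtain ⟨hmem, hprime, hLlo, hLhi, hS, hG, hat, hgood⟩ := hI
  simp only at hmem hprime hLlo hLhi hS hG hat hgood
  -- the successor `p'`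
  obtain ⟨hp'T, hpp', hmin⟩ := head_after hT.sorted hafter
  have hp'le : p' ≤ 4599989 := hT.bounded p' hp'T
  have hnoprime : ∀ q : ℕ, p < q → q < p' → ¬ q.Prime := fun q h1 h2 hq =>
    absurd (hmin q (hT.complete q hq (by omega)) h1) (not_le.2 h2)
  have hp1 : 1 ≤ p := hprime.one_lt.le
  have hp0 : 0 < p := hprime.pos
  -- unfold the step
  simp only [stepM, Nat.mul_eq, Nat.sub_eq, Nat.add_eq, natdiv_eq] at h
  obtain ⟨hg1, h⟩ := bif_not_none h
  simp only [Bool.and_eq_true] at hg1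
  obtain ⟨⟨-, hodd⟩, hchk⟩ := hg1
  have hodd' : Odd p' := Nat.odd_iff.2 (Nat.eq_of_beq_eq_true hodd)
  have hp'prime : p'.Prime := primeChk_sound hchk hodd' (by omega)
  obtain ⟨hg2, h⟩ := bif_not_none h
  rcases hln : logNext p Llo Lhi p' with _ | ⟨Llo', Lhi'⟩
  · rw [hln] at h; simp at h
  · rw [hln] at h
    simp only at h
    obtain ⟨hg3, h⟩ := bif_not_none h
    simp only [Option.some.injEq] at h
    subst h
    -- the new enclosures
    obtain ⟨hLlo', hLhi'⟩ := logNext_sound hln hp0 hpp'.le hLlo hLhi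
    have hp'R : (1 : ℝ) < p' := by exact_mod_cast hp'prime.one_lt
    have hp'0 : (0 : ℝ) < p' := by linarith
    have hS' : mertensS (p' : ℝ) = mertensS (p : ℝ) + Real.log p' / p' :=
      mertensS_succ_prime hp'prime hpp' hnoprime
    have hG' : partialG p' = partialG p + Real.log p' / ((p' : ℝ) * ((p' : ℝ) - 1)) :=
      partialG_succ_prime hp'prime hpp' hnoprime
    -- the new majorants
    have hShi' : 2 ^ 80 * mertensS (p' : ℝ) ≤ ((Shi + Lhi' / p' + 1 : ℕ) : ℝ) := by
      have hd := (natDiv_real_bounds Lhi' hp'prime.pos).2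
      have h1 : 2 ^ 80 * (Real.log p' / p') ≤ (Lhi' : ℝ) / p' := by
        rw [mul_div_assoc', div_le_div_iff_of_pos_right hp'0]; exact hLhi'
      rw [hS', mul_add]
      push_cast
      linarith
    have hGhi' : 2 ^ 80 * partialG p' ≤ ((Ghi + Lhi' / (p' * (p' - 1)) + 1 : ℕ) : ℝ) := by
      have h2 : 2 ≤ p' := hp'prime.two_le
      have hpos : 0 < p' * (p' - 1) := Nat.mul_pos hp'prime.pos (by omega)
      have hd := (natDiv_real_bounds Lhi' hpos).2
      have hcast : ((p' * (p' - 1) : ℕ) : ℝ) = (p' : ℝ) * ((p' : ℝ) - 1) := by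
        rw [Nat.cast_mul, Nat.cast_sub (by omega)]; push_cast; ring
      rw [hcast] at hd
      have hden : (0 : ℝ) < (p' : ℝ) * ((p' : ℝ) - 1) := by
        have : (2 : ℝ) ≤ p' := by exact_mod_cast h2
        nlinarith
      have h1 : 2 ^ 80 * (Real.log p' / ((p' : ℝ) * ((p' : ℝ) - 1))) ≤ (Lhi' : ℝ) / ((p' : ℝ) * ((p' : ℝ) - 1)) := by
        rw [mul_div_assoc', div_le_div_iff_of_pos_right hden]; exact hLhi'
      rw [hG', mul_add]
      push_cast
      linarith
    -- the check at `p'` (when `p' ≥ 331`)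
    have hatNew : 331 ≤ p' → 2 ^ 80 * mertensS (p' : ℝ) + ELO <
        2 ^ 80 * (Real.log p' + 1 / (2 * Real.log p')) := by
      intro h331
      simp only [Bool.or_eq_true, Nat.blt_eq] at hg3
      rcases hg3 with hlt | hc
      · omega
      · have := chkM_sound hc hp'R hLlo' hLhi'
        linarith
    refine ⟨⟨hp'T, hp'prime, hLlo', hLhi', ?_, ?_, hatNew, ?_⟩, rfl⟩
    · exact hShi'
    · exact hGhi'
    · -- the comparison below `p'`
      intro x hx hxp'
      simp only at hxp'
      by_cases hxp : x < p
      · exact hgood x hx hxp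
      · push Not at hxp
        have hSx : mertensS x = mertensS (p : ℝ) := mertensS_real_eq hnoprime hxp hxp'
        by_cases hp331 : 331 ≤ p
        · -- from the comparison at `p` and the monotonicity of the right-hand side
          have h1 := hat hp331
          have hp3 : (3 : ℝ) ≤ p := by
            have : (331 : ℝ) ≤ p := by exact_mod_cast hp331
            linarith
          have h2 := rhs_mono hp3 hxp
          rw [hSx]
          nlinarith
        · -- `p < 331`: then `p' = 331` and the `[319, 331)` check fired
          push Not at hp331
          have hp'gt : 319 < p' := by
            by_contra hh
            push Not at hh
            have : (p' : ℝ) ≤ 319 := by exact_mod_cast hh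
            linarith
          have hp'le331 : p' ≤ 331 := hmin 331 (hT.complete 331 prime_331 (by norm_num)) hp331
          have hp'eq : p' = 331 := eq_331_of_prime hp'prime hp'gt hp'le331
          simp only [Bool.or_eq_true, Bool.not_eq_true'] at hg2
          rcases hg2 with hne | hc
          · exact absurd (by rw [hp'eq]) (Nat.ne_of_beq_eq_false hne)
          · have h319 := chk319_sound hc
            have h2 := rhs_mono (x := 319) (y := x) (by norm_num) hx
            rw [hSx]
            nlinarith

/-! ### The run -/

/-- **Soundness of a run** along the table cursor. [folklore] -/
theorem runM_sound : ∀ (fuel : ℕ) {s s' : MS}, Inv s → runM fuel s (after s.p table) = some s' →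
    Inv s'
  | 0, s, s', hI, h => by
      simp only [runM, Option.some.injEq] at h
      exact h ▸ hI
  | fuel + 1, s, s', hI, h => by
      rcases hseg : after s.p table with _ | ⟨p', rest⟩
      · rw [hseg] at h
        simp only [runM, Option.some.injEq] at h
        exact h ▸ hI
      · rw [hseg] at h
        simp only [runM] at h
        rcases hst : stepM s p' with _ | s₁
        · rw [hst] at h; simp at h
        · rw [hst] at h
          simp only at h
          obtain ⟨hI₁, hp₁⟩ := stepM_inv hI hseg hst
          have hrest : rest = after s₁.p table := by
            rw [hp₁]; exact tail_after tableOK.sorted hseg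
          rw [hrest] at h
          exact runM_sound fuel hI₁ h

/-- **Soundness of a chunk**: `runDM` preserves the invariant. [folklore] -/
theorem runDM_sound {fuel : ℕ} {s s' : MS} (hI : Inv s) (h : runDM fuel s = some s') : Inv s' :=
  runM_sound fuel hI h

/-! ### The initial state -/

/-- `S(2) = (log 2)/2`. [folklore] -/
theorem mertensS_two : mertensS (2 : ℝ) = Real.log 2 / 2 := by
  have hset : Nat.primesLE 2 = {2} := by decide
  have : mertensS (2 : ℝ) = ∑ p ∈ Nat.primesLE 2, Real.log p / p := by
    simp only [mertensS]
    norm_num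
  rw [this, hset, Finset.sum_singleton]
  norm_num

/-- `∑_{p ≤ 2} (log p)/(p(p−1)) = (log 2)/2`. [folklore] -/
theorem partialG_two : partialG 2 = Real.log 2 / 2 := by
  have hset : Nat.primesLE 2 = {2} := by decide
  rw [partialG, hset, Finset.sum_singleton]
  norm_num

/-- **The initial state satisfies the invariant.** [folklore] -/
theorem initM_inv : Inv initM := by
  have hd := (natDiv_real_bounds L2HIN (b := 2) (by norm_num)).2
  have h2 := le_L2HIN
  refine ⟨tableOK.two_mem, Nat.prime_two, ?_, ?_, ?_, ?_, ?_, ?_⟩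
  · simpa [initM] using L2LON_le
  · simpa [initM] using le_L2HIN
  · simp only [initM, Nat.add_eq, natdiv_eq]
    push_cast
    rw [mertensS_two]
    linarith
  · simp only [initM, Nat.add_eq, natdiv_eq]
    push_cast
    rw [partialG_two]
    linarith
  · simp [initM]
  · intro x hx hx2
    simp only [initM] at hx2
    push_cast at hx2
    linarith

/-! ### The conclusions from a finished run -/

/-- **(3.22) from a finished run**: if the invariant holds at a state whose prime `P` is `≥ 331`, and
`−ELO/2⁸⁰ ≤ E`, then `∑_{p ≤ x} (log p)/p < log x + E + 1/(2 log x)` for every real `319 ≤ x ≤ P`.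
[cite: RosserSchoenfeld1962, Thm. 6 (3.22)] -/
theorem eq_3_22_of_inv {s : MS} (hI : Inv s) (hP : 331 ≤ s.p)
    (hE : -(ELO : ℝ) / 2 ^ 80 ≤ rosserSchoenfeldE) {x : ℝ} (hx : 319 ≤ x) (hxP : x ≤ s.p) :
    ∑ p ∈ Nat.primesLE ⌊x⌋₊, Real.log p / p < Real.log x + rosserSchoenfeldE + 1 / (2 * Real.log x) := by
  have h : 2 ^ 80 * mertensS x + ELO < 2 ^ 80 * (Real.log x + 1 / (2 * Real.log x)) := by
    rcases lt_or_eq_of_le hxP with hlt | heq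
    · exact hI.good x hx hlt
    · rw [heq]; exact hI.at_p hP
  have hE' : -(ELO : ℝ) ≤ 2 ^ 80 * rosserSchoenfeldE := by
    rw [div_le_iff₀ (by positivity)] at hE; linarith
  have : 2 ^ 80 * mertensS x < 2 ^ 80 * (Real.log x + rosserSchoenfeldE + 1 / (2 * Real.log x)) := by
    linarith
  exact lt_of_mul_lt_mul_left this (by positivity)

/-- `GAMMAHIN = ⌈0.57721571 · 2⁸⁰⌉ ≥ 2⁸⁰ γ` (the tree's `γ < 0.57721571`). [folklore] -/
def GAMMAHIN : ℕ := 697810975306190105464740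

/-- `2⁸⁰ γ ≤ GAMMAHIN`. [folklore] -/
theorem le_GAMMAHIN : 2 ^ 80 * Real.eulerMascheroniConstant ≤ (GAMMAHIN : ℝ) := by
  have h := Literature.Analysis.SpecialFunctions.Real.eulerMascheroniConstant_lt_d8
  have : 2 ^ 80 * (0.57721571 : ℝ) ≤ (GAMMAHIN : ℝ) := by norm_num [GAMMAHIN]
  nlinarith

/-- **`∑_p (log p)/(p(p−1)) ≤ partialG P + (log P + 2)/P`** for `P ≥ 1` (the primes beyond `P` are
among the integers `n > P`, and `∑_{n > P} log n/(n(n−1)) ≤ (log P + 2)/P` telescopes).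
[cite: RosserSchoenfeld1962, (2.10)–(2.11)] -/
theorem tsum_primes_le_partialG_add {P : ℕ} (hP : 1 ≤ P) :
    ∑' p : Nat.Primes, Real.log (p : ℝ) / ((p : ℝ) * ((p : ℝ) - 1)) ≤
      partialG P + (Real.log P + 2) / P := by
  set g : ℕ → ℝ := fun n ↦ Real.log (n : ℝ) / ((n : ℝ) * ((n : ℝ) - 1)) with hg
  have hsub : ∑' p : Nat.Primes, g p = ∑' n : ℕ, (setOf Nat.Prime).indicator g n :=
    tsum_subtype (setOf Nat.Prime) g
  have hsumP : Summable (g ∘ ((↑) : (setOf Nat.Prime) → ℕ)) :=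
    RosserSchoenfeld.summable_primes_log_div_mul_pred
  have hsum : Summable ((setOf Nat.Prime).indicator g) := summable_subtype_iff_indicator.mp hsumP
  have hind : ∀ n, (setOf Nat.Prime).indicator g n = if n.Prime then g n else 0 := fun n ↦ by
    simp only [Set.indicator_apply, Set.mem_setOf_eq]
  have hgnn : ∀ n : ℕ, 2 ≤ n → 0 ≤ g n := fun n hn ↦ by
    have : (2 : ℝ) ≤ n := by exact_mod_cast hn
    exact div_nonneg (Real.log_nonneg (by linarith)) (by nlinarith)
  have hindnn : ∀ n : ℕ, 0 ≤ (setOf Nat.Prime).indicator g n := fun n ↦ by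
    rw [hind]
    split_ifs with hp
    · exact hgnn n hp.two_le
    · exact le_rfl
  change ∑' p : Nat.Primes, g p ≤ _
  rw [hsub, ← Summable.sum_add_tsum_nat_add (P + 1) hsum]
  -- the head is `partialG P`
  have hhead : ∑ i ∈ Finset.range (P + 1), (setOf Nat.Prime).indicator g i = partialG P := by
    rw [partialG, Nat.primesLE, Nat.primesBelow, Finset.sum_filter]
    exact Finset.sum_congr rfl fun i _ ↦ hind i
  -- the tail
  have htail : ∑' i : ℕ, (setOf Nat.Prime).indicator g (i + (P + 1)) ≤ (Real.log P + 2) / P := by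
    refine Real.tsum_le_of_sum_range_le (fun i ↦ hindnn _) (fun m ↦ ?_)
    calc ∑ i ∈ Finset.range m, (setOf Nat.Prime).indicator g (i + (P + 1))
        ≤ ∑ i ∈ Finset.range m, g (i + P + 1) := by
          refine Finset.sum_le_sum fun i _ ↦ ?_
          rw [hind, show i + (P + 1) = i + P + 1 by ring]
          split_ifs
          · exact le_rfl
          · exact hgnn _ (by omega)
      _ ≤ (Real.log (P : ℕ) + 2) / (P : ℕ) := RosserSchoenfeld.sum_range_log_div_mul_pred_le P m hP
  rw [hhead]
  linarith

/-- **The lower bound for `E` from a finished run**: if the invariant holds at a state at the prime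
`P` and `GAMMAHIN + Ghi + ⌊(Lhi + 2·2⁸⁰)/P⌋ + 1 ≤ ELO`, then `−ELO/2⁸⁰ ≤ E`
(`E = −γ − ∑_p (log p)/(p(p−1)) ≥ −γ − Ghi/2⁸⁰ − (log P + 2)/P`). [cite: RosserSchoenfeld1962, (2.11)] -/
theorem rosserSchoenfeldE_ge_of_inv {s : MS} (hI : Inv s)
    (hnum : GAMMAHIN + s.Ghi + ((s.Lhi + 2 * SC) / s.p + 1) ≤ ELO) :
    -(ELO : ℝ) / 2 ^ 80 ≤ rosserSchoenfeldE := by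
  have hP1 : 1 ≤ s.p := hI.prime.one_lt.le
  have hP0 : (0 : ℝ) < s.p := by exact_mod_cast hI.prime.pos
  have hG := tsum_primes_le_partialG_add hP1
  have hγ := le_GAMMAHIN
  have hGhi := hI.G_le
  have hLhi := hI.le_Lhi
  -- the tail in fixed point
  have hd := (natDiv_real_bounds (s.Lhi + 2 * SC) hI.prime.pos).2
  push_cast at hd
  rw [SC_real] at hd
  have htail : 2 ^ 80 * ((Real.log s.p + 2) / s.p) ≤ (((s.Lhi + 2 * SC) / s.p + 1 : ℕ) : ℝ) := by
    have h1 : 2 ^ 80 * ((Real.log s.p + 2) / s.p) ≤ ((s.Lhi : ℝ) + 2 * 2 ^ 80) / s.p := by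
      rw [mul_div_assoc', div_le_div_iff_of_pos_right hP0]; linarith
    push_cast
    linarith
  have hnumR : ((GAMMAHIN : ℝ) + s.Ghi + (((s.Lhi + 2 * SC) / s.p + 1 : ℕ) : ℝ)) ≤ ELO := by
    exact_mod_cast hnum
  rw [rosserSchoenfeldE, div_le_iff₀ (by positivity)]
  nlinarith

end Literature.NumberTheory.LFunctions.MertensFirstChain

end
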